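import Summits.QuantumFields.BalabanUV.T4Continuum.Spine.NE1p.DressedSmallFieldMixedLetter

/-!
# T⁴ programme, spine estimate NE1′ (node O3b/H2) — THE MIXED DIFFERENCE IN CLOSED FORM: `Δ_S F = Σ_{T ⊆ S} (−1)^{#S−#T}·F(𝟙_T)`
# (inclusion–exclusion over the active cubes); ONE MORE ACTIVE CUBE = ONE MORE FIRST-ORDER DIFFERENCE; A DECOUPLED CUBE KILLS THE TERM;
# RELABELLING THE CUBES (the dictionary is enumeration-free along any `ι ≃ Fin n`); and the trivial `2^{#S}` bound — SHARP — that (2.15)'s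
# analyticity on the big σ(Δ)-circles improves to `e^{−(κ₁−1)·#S}`

Cell `pub-balaban`, sub-cell `t4`, row NE1′ formalisation crew (`t4/formal/NE1p/LEAVES.md` row W76 ∕ DAG N29zzzzf, BOOKED typer R-T139 — own-initiative
DICTIONARY follower of the unit's W39∕W55∕W60∕W62∕W70∕W74 under typer R-T61 (ii); g11 handoff NATURAL NEXT (a) «index-free transport along `J ≃ Fin n`»;
read X209), unit `b2b-balaban-t4-ne1p-formalise-leaf-08` (gen 12).  ADDITIVE — imports W39.1 `Spine/NE1p/DressedSmallFieldMixedLetter` ONLY (`mixedDiff`, `tailSet`∕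
`mem_tailSet`, `mixedDiff_pair`, `mixedDiff_prod` BY NAME).  THEOREMS ONLY + three decided `example`s; 0 `def`, 0 `instance`, 0 `def … : Prop`, 0 cite,
0 sorry, 0 `attribute`; nothing of W39.1 restated; pure algebra over `ℂ` — no measure, no analyticity (the vertex `𝟙_T` is W55's `basePt T 1`, TYPE).

WHY THIS FILE.  [Balaban1988RGII] p. 14 (2.8) applies «Π_{Δ⊂Z∖Z̃′₀} ∫₀¹ ds(Δ) ∂∕∂s(Δ)» to ONE expression and sums «Σ_Z»; p. 6: «If a term … does
not depend on s(Δ) … then the derivative … is equal to 0» is the mechanism by which only CONNECTED clusters survive (LOCI ∕ paraphrase of the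
audited manuscript's construction, TYPE∕CONTEXT only — the second is this file's reading of the standard decoupling step, not a quotation).  W39.1
defined Bałaban's difference form `mixedDiff n S F` by RECURSION along `Fin.cons` (head cube first); every later dictionary row (W55's contours at
fixed `s`, W62's FTC, W70's split) followed that recursion.  What the recursion hides is the CLOSED FORM and its three structural consequences,
none of which needs a contour or an interpolation integral:
* §1 **`mixedDiff_empty`** (no active cube: evaluation at the decoupled point `0`); **`mixedDiff_insert`**: for `j ∉ S`,
  `Δ_{S ∪ {j}} F = Δ_S (F∘[z_j ↦ 1]) − Δ_S (F∘[z_j ↦ 0])` — ONE MORE ACTIVE CUBE IS ONE MORE FIRST-ORDER DIFFERENCE, in ANY position `j`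
  (W39.1's recursion is the case `j = 0`; induction along `Fin.cons` with Mathlib `Fin.cons_update`∕`update_cons_zero`); hence
  **`mixedDiff_eq_zero_of_forall_update_eq`**: if `F` does not see the active cube `j ∈ S` (`F(z[j ↦ 1]) = F(z[j ↦ 0])`), then `Δ_S F = 0` —
  A DECOUPLED CUBE KILLS THE TERM;
* §2 **`mixedDiff_eq_sum_powerset`**: `Δ_S F = Σ_{T ∈ 𝒫(S)} (−1)^{#S − #T} · F(𝟙_T)`, `𝟙_T` the vertex of the unit cube with ones exactly on `T`
  (Finset induction on `S` through §1 + Mathlib `Finset.sum_powerset_insert`); hence **`mixedDiff_congr_vertices`** (`Δ_S F` depends only on the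
  `2^{#S}` vertex values) and **`norm_mixedDiff_le_two_pow`**: `‖Δ_S F‖ ≤ 2^{#S}·B` under `‖F(𝟙_T)‖ ≤ B` — the TRIVIAL bound, with NO analyticity;
  the lineage's `norm_mixedDiff_le_lemma19` (`A·e^{−(κ₁−1)·#S}`, analyticity on the polydisc of radius `e^{κ₁}`) and W39.1's `mixedLetter_decay_le`
  are what (1.24)∕(2.15)'s «exp(−(κ₁ − 1)·#cubes)» (TYPE) buys over it;
* §3 RELABELLING THE CUBES: **`sum_powerset_map`** ([folklore] reindexing a powerset sum along an embedding), **`mixedDiff_map_perm`**: for a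
  permutation `σ` of the cubes, `Δ_{σ(S)} F = Δ_S (F ∘ (· ∘ σ⁻¹))`; and the INDEX-FREE TRANSPORT **`mixedDiff_transport_eq_sum`**: for ANY finite
  index type `ι`, ANY `e : ι ≃ Fin n`, `S : Finset ι`, `F : (ι → ℂ) → ℂ`, `Δ_{e(S)} (F ∘ (· ∘ e)) = Σ_{T ⊆ S} (−1)^{#S−#T} F(𝟙_T)` — the right side
  does not mention `e` (**`mixedDiff_transport_indep`**): W39.1's `Fin n`-dictionary serves the substrate's general index types (`Jc ⊕ 𝒴`,
  `Support/B13TermContours` §3) WITHOUT a choice of enumeration mattering — the difference-form companion of W60's `mixedDeriv_perm`;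
* §4 decided `example`s: the closed form at `n = 2` reproduces W39.1's `mixedDiff_pair`; the `2^{#S}` bound is ATTAINED by the entire product
  `Π_j (1 − 2z_j)` (`Δ_{univ} = 4 = 2²` on `Fin 2` with vertex values `±1`, via W39.1 `mixedDiff_prod`); a factor ignoring cube `1` has `Δ_{01} = 0`.

HONEST FRAMING.  [folklore] finite combinatorics (inclusion–exclusion on the Boolean cube, reindexing of powerset sums) on OUR dictionary object
`mixedDiff`; a DICTIONARY row, not an estimate of print: `F` ↔ print's s(Δ)-dependent operator products ((1.10)∕(2.7)∕(2.8)) is a TYPE READING;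
the «decoupled cube kills the term» lemma is the algebraic shadow of the connectedness mechanism, NOT a statement about Bałaban's densities; no
numeral of [Balaban1988RGII] asserted (k2) — `2^{#S}`, `4`, `±1` are OUR combinatorics; (B1) for Bałaban's (2.14) NOT discharged; (B3) = GAPS
G-ne9p2-5 UNPRINTED — NOT discharged, untouched; (B5) untouched; 0 binders instantiated on Bałaban's densities ∕ operators ∕ (2.14) data ∕ `d_k` ∕
minimisers ∕ backgrounds; discharges no wall item; wall v1.8 (T4-DAG v48) does NOT move; R-t4r2-Q2 NOT met thereby; NE1′ ⇐ the named binders —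
NOT proved, NOT printed; spine PROVED 0∕9; count 9 unchanged.  Rung (B)+1 on ONE finite four-torus — NOT infinite volume, NOT a mass gap, NOT OS
on ℝ⁴, NOT Clay.  ABSOLUTE RULE honoured: the quotation is a LOCUS of the audited manuscript [Balaban1988RGII] (CMP 116 (1988) 1–22, p. 14),
TYPE∕CONTEXT only, never a hypothesis-free fact; nothing internally minted is cited; [folklore] tags on kernel lemmas only.  HONEST DEPENDENCY:
continuum YM on T⁴ ⇐ BetaPertH ∧ nine spine estimates (0/9 proved); BetaPertH ⇐ (D1) ∧ (D4) ∧ CAP+tail; G-an2-4 gates asym, D1 and NE2/3/4.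
-/

noncomputable section

namespace Summit.QuantumFields.BalabanUV.T4Continuum.NE1p.DressedSmallFieldMixedDifferenceClosedForm

open Finset Function
open Summit.QuantumFields.BalabanUV.T4Continuum.NE1p.DressedSmallFieldMixedLetter

variable {n : ℕ}

/-! ## §1 No cube; one more cube; a decoupled cube -/

/-- [folklore] The tail set of the empty active set is empty. -/
theorem tailSet_empty : tailSet (∅ : Finset (Fin (n + 1))) = ∅ := by
  ext j; simp [mem_tailSet]

/-- [folklore] The tail set of an insertion at a successor ∕ at the head. -/
theorem tailSet_insert_succ (i : Fin n) (S : Finset (Fin (n + 1))) : tailSet (insert i.succ S) = insert i (tailSet S) := by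
  ext j; simp [mem_tailSet, Fin.succ_inj]

/-- [folklore] Inserting the head cube does not change the tail set. -/
theorem tailSet_insert_zero (S : Finset (Fin (n + 1))) : tailSet (insert 0 S) = tailSet S := by
  ext j; simp [mem_tailSet, Fin.succ_ne_zero]

/-- **NO ACTIVE CUBE: EVALUATION AT THE DECOUPLED POINT** [folklore]: `Δ_∅ F = F(0)` (every variable frozen at `0`). -/
theorem mixedDiff_empty : ∀ (n : ℕ) (F : (Fin n → ℂ) → ℂ), mixedDiff n ∅ F = F 0
  | 0, F => congrArg F (funext fun i => i.elim0)
  | n + 1, F => by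
      have h0 : (0 : Fin (n + 1)) ∉ (∅ : Finset (Fin (n + 1))) := by simp
      simp only [mixedDiff, if_neg h0, tailSet_empty, mixedDiff_empty n]
      exact congrArg F (by funext j; induction j using Fin.cases <;> simp)

/-- **ONE MORE ACTIVE CUBE IS ONE MORE FIRST-ORDER DIFFERENCE, IN ANY POSITION** [folklore] (induction along `Fin.cons`; Mathlib
`Fin.update_cons_zero`∕`Fin.cons_update`): for `j ∉ S`, `Δ_{S ∪ {j}} F = Δ_S (z ↦ F(z[j ↦ 1])) − Δ_S (z ↦ F(z[j ↦ 0]))` — W39.1's defining recursion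
is the case `j = 0`; the first-order differences in different cubes COMMUTE (which is why (2.8) may write an unordered `Π_Δ`). -/
theorem mixedDiff_insert : ∀ (n : ℕ) (j : Fin n) (S : Finset (Fin n)) (F : (Fin n → ℂ) → ℂ), j ∉ S →
    mixedDiff n (insert j S) F = mixedDiff n S (fun z => F (update z j 1)) - mixedDiff n S (fun z => F (update z j 0))
  | 0, j, _, _, _ => j.elim0
  | n + 1, j, S, F, hj => by
      induction j using Fin.cases with
      | zero =>
          have h0 : (0 : Fin (n + 1)) ∈ insert 0 S := mem_insert_self _ _
          simp only [mixedDiff, if_pos h0, if_neg hj, tailSet_insert_zero, Fin.update_cons_zero]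
      | succ i =>
          have hi : i ∉ tailSet S := fun h => hj (mem_tailSet.1 h)
          have hmem : ((0 : Fin (n + 1)) ∈ insert i.succ S) ↔ (0 : Fin (n + 1)) ∈ S := by
            simp [(Fin.succ_ne_zero i).symm]
          have IH := fun (G : (Fin n → ℂ) → ℂ) => mixedDiff_insert n i (tailSet S) G hi
          by_cases h0 : (0 : Fin (n + 1)) ∈ S
          · simp only [mixedDiff, hmem, if_pos h0, tailSet_insert_succ, IH, ← Fin.cons_update]
            ring
          · simp only [mixedDiff, hmem, if_neg h0, tailSet_insert_succ, IH, ← Fin.cons_update]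

/-- **A DECOUPLED CUBE KILLS THE TERM** [folklore] (§1 `mixedDiff_insert` at `S = insert j (S.erase j)`): if the factor does not see the active cube
`j ∈ S` — `F(z[j ↦ 1]) = F(z[j ↦ 0])` for every `z` — then `Δ_S F = 0`: the algebraic shadow of the decoupling step (a term not depending on `s(Δ)`
is annihilated by `∂∕∂s(Δ)`, so only clusters CONNECTED through the dependence survive in (2.8)'s `Σ_Z` — a reading of the construction, TYPE). -/
theorem mixedDiff_eq_zero_of_forall_update_eq {j : Fin n} {S : Finset (Fin n)} (hj : j ∈ S) {F : (Fin n → ℂ) → ℂ}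
    (hF : ∀ z, F (update z j 1) = F (update z j 0)) : mixedDiff n S F = 0 := by
  rw [← insert_erase hj, mixedDiff_insert n j (S.erase j) F (notMem_erase j S)]
  simp only [hF, sub_self]

/-! ## §2 THE CLOSED FORM: inclusion–exclusion over the active cubes -/

/-- [folklore] The vertex `𝟙_T` updated at a cube `j ∉ T`: setting `z_j ↦ 1` gives the vertex `𝟙_{T ∪ {j}}`, setting `z_j ↦ 0` changes nothing. -/
theorem update_indicator_one {j : Fin n} {T : Finset (Fin n)} (hj : j ∉ T) :
    update (fun i => if i ∈ T then (1 : ℂ) else 0) j 1 = fun i => if i ∈ insert j T then (1 : ℂ) else 0 := by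
  funext i
  by_cases h : i = j
  · subst h; simp
  · simp [h]

/-- [folklore] … and `z_j ↦ 0` at `j ∉ T` is the identity on `𝟙_T`. -/
theorem update_indicator_zero {j : Fin n} {T : Finset (Fin n)} (hj : j ∉ T) :
    update (fun i => if i ∈ T then (1 : ℂ) else 0) j 0 = fun i => if i ∈ T then (1 : ℂ) else 0 := by
  funext i
  by_cases h : i = j
  · subst h; simp [hj]
  · simp [update_of_ne h]

/-- **THE MIXED DIFFERENCE IN CLOSED FORM** [folklore] (Finset induction on the active set through §1's `mixedDiff_empty`∕`mixedDiff_insert` and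
Mathlib `Finset.sum_powerset_insert`): `Δ_S F = Σ_{T ∈ 𝒫(S)} (−1)^{#S − #T} · F(𝟙_T)` — inclusion–exclusion over the `2^{#S}` vertices of the unit
cube spanned by the active cubes, inactive variables at `0`; what (2.8)'s «Π_{Δ} ∫₀¹ ds(Δ) ∂∕∂s(Δ)» (p. 14, TYPE) evaluates to on any function of
the `s(Δ)`, analytic or not. -/
theorem mixedDiff_eq_sum_powerset (S : Finset (Fin n)) (F : (Fin n → ℂ) → ℂ) :
    mixedDiff n S F = ∑ T ∈ S.powerset, (-1 : ℂ) ^ (S.card - T.card) * F (fun i => if i ∈ T then (1 : ℂ) else 0) := by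
  induction S using Finset.induction_on generalizing F with
  | empty =>
      rw [mixedDiff_empty, powerset_empty, sum_singleton]
      simp only [card_empty, Nat.sub_zero, pow_zero, one_mul, notMem_empty, if_false]
      rfl
  | @insert j S hj ih =>
      rw [mixedDiff_insert n j S F hj, ih, ih, sum_powerset_insert hj, card_insert_of_notMem hj]
      -- the subsets NOT containing `j` carry the sign `−(−1)^{#S−#T}` and the vertex `𝟙_T`; those containing `j` carry `(−1)^{#S−#T}` and `𝟙_{T∪{j}}`
      have hA : ∀ T ∈ S.powerset, (-1 : ℂ) ^ (S.card + 1 - T.card) * F (fun i => if i ∈ T then (1 : ℂ) else 0) =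
          -((-1 : ℂ) ^ (S.card - T.card) * F (update (fun i => if i ∈ T then (1 : ℂ) else 0) j 0)) := by
        intro T hT
        have hTS : T.card ≤ S.card := card_le_card (mem_powerset.1 hT)
        have hjT : j ∉ T := fun h => hj (mem_powerset.1 hT h)
        rw [update_indicator_zero hjT, show S.card + 1 - T.card = (S.card - T.card) + 1 by omega, pow_succ]
        ring
      have hB : ∀ T ∈ S.powerset, (-1 : ℂ) ^ (S.card + 1 - (insert j T).card) * F (fun i => if i ∈ insert j T then (1 : ℂ) else 0) =
          (-1 : ℂ) ^ (S.card - T.card) * F (update (fun i => if i ∈ T then (1 : ℂ) else 0) j 1) := by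
        intro T hT
        have hjT : j ∉ T := fun h => hj (mem_powerset.1 hT h)
        rw [update_indicator_one hjT, card_insert_of_notMem hjT, Nat.add_sub_add_right]
      rw [sum_congr rfl hA, sum_congr rfl hB, sum_neg_distrib]
      ring

/-- **`Δ_S F` DEPENDS ONLY ON THE VERTEX VALUES** [folklore] (§2): two factors agreeing on the `2^{#S}` vertices `𝟙_T`, `T ⊆ S`, have the same
mixed difference — in particular nothing about `F` between the vertices (let alone on the σ(Δ)-circles) enters the VALUE; the circles enter
only the BOUND. -/
theorem mixedDiff_congr_vertices {S : Finset (Fin n)} {F G : (Fin n → ℂ) → ℂ}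
    (h : ∀ T ∈ S.powerset, F (fun i => if i ∈ T then (1 : ℂ) else 0) = G (fun i => if i ∈ T then (1 : ℂ) else 0)) :
    mixedDiff n S F = mixedDiff n S G := by
  rw [mixedDiff_eq_sum_powerset, mixedDiff_eq_sum_powerset]
  exact sum_congr rfl fun T hT => by rw [h T hT]

/-- **THE TRIVIAL BOUND `2^{#S}`** [folklore] (§2 + `Finset.card_powerset`): if `‖F(𝟙_T)‖ ≤ B` on the vertices then `‖Δ_S F‖ ≤ 2^{#S}·B` — with NO
analyticity.  The lineage's analytic bounds (`norm_mixedDiff_le_lemma19`: `A·e^{−(κ₁−1)·#S}` from analyticity on the polydisc of radius `e^{κ₁}`;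
W39.1 `mixedLetter_decay_le` by the contours) are exactly what (1.24)∕(2.15)'s «exp(−(κ₁ − 1)·#cubes)» (TYPE) buys over this: the growth `2^{#S}`
becomes DECAY, paid for by control of `F` far outside the unit cube. -/
theorem norm_mixedDiff_le_two_pow (S : Finset (Fin n)) {F : (Fin n → ℂ) → ℂ} {B : ℝ}
    (hB : ∀ T ∈ S.powerset, ‖F (fun i => if i ∈ T then (1 : ℂ) else 0)‖ ≤ B) :
    ‖mixedDiff n S F‖ ≤ 2 ^ S.card * B := by
  rw [mixedDiff_eq_sum_powerset]
  calc ‖∑ T ∈ S.powerset, (-1 : ℂ) ^ (S.card - T.card) * F (fun i => if i ∈ T then (1 : ℂ) else 0)‖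
      ≤ ∑ T ∈ S.powerset, ‖(-1 : ℂ) ^ (S.card - T.card) * F (fun i => if i ∈ T then (1 : ℂ) else 0)‖ := norm_sum_le _ _
    _ ≤ ∑ T ∈ S.powerset, B := sum_le_sum fun T hT => by
        rw [norm_mul, norm_pow, norm_neg, norm_one, one_pow, one_mul]; exact hB T hT
    _ = 2 ^ S.card * B := by rw [sum_const, card_powerset, nsmul_eq_mul]; push_cast; ring

/-! ## §3 RELABELLING THE CUBES: the dictionary is enumeration-free -/

/-- [folklore] **Reindexing a powerset sum along an embedding**: `Σ_{T ⊆ e(S)} g(T) = Σ_{T′ ⊆ S} g(e(T′))` (Mathlib `Finset.subset_map_iff` for the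
bijection, `Finset.sum_map`). -/
theorem sum_powerset_map {α β M : Type*} [AddCommMonoid M] (e : α ↪ β) (S : Finset α) (g : Finset β → M) :
    ∑ T ∈ (S.map e).powerset, g T = ∑ T' ∈ S.powerset, g (T'.map e) := by
  have hpow : (S.map e).powerset = S.powerset.map ⟨fun T' => T'.map e, map_injective e⟩ := by
    ext T
    simp only [mem_powerset, mem_map, Embedding.coeFn_mk]
    constructor
    · intro h
      obtain ⟨u, hu, rfl⟩ := subset_map_iff.1 h
      exact ⟨u, hu, rfl⟩
    · rintro ⟨u, hu, rfl⟩
      exact map_subset_map.2 hu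
  rw [hpow, sum_map]
  rfl

/-- [folklore] The vertex of a relabelled subset, read through the relabelling: for `e : α ≃ β`, `𝟙_{e(T)}(e(a)) = 𝟙_T(a)`. -/
theorem indicator_map_equiv {α β : Type*} [DecidableEq α] [DecidableEq β] (e : α ≃ β) (T : Finset α) :
    (fun b : β => if b ∈ T.map e.toEmbedding then (1 : ℂ) else 0) ∘ e = fun a => if a ∈ T then (1 : ℂ) else 0 := by
  funext a
  simp only [comp_apply, mem_map_equiv, Equiv.symm_apply_apply]

/-- **RELABELLING THE CUBES BY A PERMUTATION** [folklore] (§2's closed form on both sides + `sum_powerset_map` + `card_map`): for a permutation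
`σ` of `Fin n`, `Δ_{σ(S)} F = Δ_S (z ↦ F(z ∘ σ⁻¹))` — the difference form does not care how the cubes are numbered (the companion, for Bałaban's
DIFFERENCE, of W60's `mixedDeriv_perm` for Dimock's DERIVATIVE). -/
theorem mixedDiff_map_perm (σ : Equiv.Perm (Fin n)) (S : Finset (Fin n)) (F : (Fin n → ℂ) → ℂ) :
    mixedDiff n (S.map σ.toEmbedding) F = mixedDiff n S (fun z => F (z ∘ σ.symm)) := by
  rw [mixedDiff_eq_sum_powerset, mixedDiff_eq_sum_powerset, sum_powerset_map, card_map]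
  refine sum_congr rfl fun T _ => ?_
  rw [card_map]
  congr 1
  exact congrArg F (by rw [← indicator_map_equiv σ T]; funext i; simp)

/-- **INDEX-FREE TRANSPORT** [folklore]: for ANY finite index type `ι` (the substrate's cube index `Jc`, `Support/B13TermContours` §3), ANY
enumeration `e : ι ≃ Fin n`, `S : Finset ι` and `F : (ι → ℂ) → ℂ`, the transported difference `Δ_{e(S)} (z ↦ F(z ∘ e))` EQUALS the
enumeration-free inclusion–exclusion sum `Σ_{T ⊆ S} (−1)^{#S−#T} F(𝟙_T)` over the vertices of the `ι`-indexed unit cube. -/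
theorem mixedDiff_transport_eq_sum {ι : Type*} [DecidableEq ι] (e : ι ≃ Fin n) (S : Finset ι) (F : (ι → ℂ) → ℂ) :
    mixedDiff n (S.map e.toEmbedding) (fun z => F (z ∘ e)) =
      ∑ T ∈ S.powerset, (-1 : ℂ) ^ (S.card - T.card) * F (fun a => if a ∈ T then (1 : ℂ) else 0) := by
  rw [mixedDiff_eq_sum_powerset, sum_powerset_map, card_map]
  refine sum_congr rfl fun T _ => ?_
  rw [card_map, indicator_map_equiv e T]

/-- **… HENCE DOES NOT DEPEND ON THE ENUMERATION** [folklore]: two enumerations `e, e′ : ι ≃ Fin n` transport `(S, F)` to the SAME number —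
W39.1's `Fin n`-dictionary (and, through W62∕W70, its contour and derivative companions) serves a general finite cube index without a choice of
numbering mattering. -/
theorem mixedDiff_transport_indep {ι : Type*} [DecidableEq ι] (e e' : ι ≃ Fin n) (S : Finset ι) (F : (ι → ℂ) → ℂ) :
    mixedDiff n (S.map e.toEmbedding) (fun z => F (z ∘ e)) = mixedDiff n (S.map e'.toEmbedding) (fun z => F (z ∘ e')) := by
  rw [mixedDiff_transport_eq_sum, mixedDiff_transport_eq_sum]

/-! ## §4 Decided checks -/

/-- DECIDED CHECK (consistency with W39.1's two-cube face): at `n = 2`, `S = {0, 1}` the closed form has the four vertices `(1,1), (1,0), (0,1),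
(0,0)` with signs `+ − − +` — `mixedDiff_pair`'s `F(1,1) − F(1,0) − (F(0,1) − F(0,0))`, for EVERY `F`. -/
example (F : (Fin 2 → ℂ) → ℂ) :
    ∑ T ∈ ({0, 1} : Finset (Fin 2)).powerset, (-1 : ℂ) ^ (({0, 1} : Finset (Fin 2)).card - T.card) * F (fun i => if i ∈ T then (1 : ℂ) else 0) =
      F ![1, 1] - F ![1, 0] - (F ![0, 1] - F ![0, 0]) := by
  rw [← mixedDiff_eq_sum_powerset, mixedDiff_pair]

/-- DECIDED CHECK (the trivial bound is SHARP, even for an ENTIRE factor): for the product `F(z) = (1 − 2z₀)(1 − 2z₁)` every vertex value is `±1`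
(`B = 1`) and `Δ_{01} F = (−2)·(−2) = 4 = 2^{#S}` (W39.1 `mixedDiff_prod`) — decay below `2^{#S}` is NOT a property of the difference operator; in
(2.15) it comes from the bound on the circles of radius `e^{κ₁}`, where this `F` is large (`(1 + 2e^{κ₁})²`). -/
example : mixedDiff 2 {0, 1} (fun z : Fin 2 → ℂ => ∏ j ∈ ({0, 1} : Finset (Fin 2)), (1 - 2 * z j)) = 2 ^ ({0, 1} : Finset (Fin 2)).card := by
  rw [mixedDiff_prod 2 {0, 1} (fun _ w => 1 - 2 * w)]
  norm_num

/-- DECIDED CHECK (a decoupled cube kills the term): `F(z) = e^{z₀}` does not see cube `1`, so `Δ_{01} F = 0` (§1) — although `Δ_{0} F = e − 1 ≠ 0`. -/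
example : mixedDiff 2 {0, 1} (fun z : Fin 2 → ℂ => Complex.exp (z 0)) = 0 :=
  mixedDiff_eq_zero_of_forall_update_eq (j := 1) (by simp) fun z => by simp

end Summit.QuantumFields.BalabanUV.T4Continuum.NE1p.DressedSmallFieldMixedDifferenceClosedForm

end
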